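import Summits.HodgeConjecture.HodgeConjecture.Theses.PeriodDeficiency
import Literature.AlgebraicGeometry.Motives.HodgeTensorFactsHolds
import Literature.AlgebraicGeometry.Motives.BettiHodgeClassicalPinIndependence
import Literature.AlgebraicGeometry.Motives.FamiliesVHSFiniteFiber
import HarnessLib

/-!
# Route `PeriodDeficiency`, support item `ClassicalGeometricVHS`: reductions

`ClassicalGeometricVHS` (item stmt-HodgeConjecture-11597) is the CONSTRUCTION debt of the route:
`∃ B : BettiHodgeData ℂ, B.IsClassical ∧ HodgeTensorFacts ∧ ∀` smooth projective `ℚ̄`-families over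
smooth irreducible bases, `∀ n i, ∃ D : GeometricVHSData B (f₀ ⊗_σ ℂ) n i` with finite-dimensional
`ℚ`-fibres. This helper file records, sorry-free, how much of it is bookkeeping:

* `classicalGeometricVHS_iff` — with Deligne's tensor-filtration facts now a theorem
  (`Motives.hodgeTensorFacts_holds`, Hodge II 1.1.6–1.1.12) and the fibres of ANY geometric VHS
  datum finite dimensional (`Motives.GeometricVHSData.finite_fiber`: `V_s ≃ Hⁱ(𝒳_s)` and axiom (A)
  of the Weil cohomology theory `B.W`), the item is EQUIVALENT to
  `∃ B, B.IsClassical ∧ ∀ families, Nonempty (GeometricVHSData B (f₀ ⊗_σ ℂ) n i)`.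
  What remains are the two genuine constructions: (1) a classical Betti–Hodge datum
  (`∃ B, B.IsClassical`: Betti cohomology of smooth projective complex varieties is a Weil
  cohomology theory whose Hodge structures are those of `X^an` for EVERY Hodge model — Voisin I
  Thm. 6.19, §7.1, §11.3, plus the model-independence fact `HodgeTheory.hodgePQ_independent_of_hodgeModel`),
  and (2) for that `B`, geometric VHS data on every smooth projective family over a smooth
  irreducible `ℚ̄`-base (Ehresmann + proper base change + a flat polarisation; Voisin II §3.1.1,
  Deligne Hodge II 4.1.1). Neither is constructed in the tree (module docstring of
  `Motives/PeriodRealizationClassical`: "No instance is constructed here or anywhere in the tree").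
* `hodgePQ_independent_of_classicalGeometricVHS` — a LOWER BOUND on the debt: the item implies the
  tree's open named fact `HodgeTheory.hodgePQ_independent_of_hodgeModel` (all Hodge models of a
  smooth projective `X` cut out the same `H^{p,q}` on `Hᵏ(X(ℂ); ℂ)`), because `IsClassical` pins
  `B.hodge` through EVERY Hodge model and the comparison `ℂ ⊗ Hᵏ(X) → Hᵏ(X(ℂ); ℂ)` is onto
  (`Motives.BettiHodgeData.IsClassical.hodgePQ_independent`). So the item cannot be settled before
  that fact (reduced in `HodgeTheory/HodgeFiltrationModelsRigidity` to
  `NaturalDeRhamComparisonRigidity`) is.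

## References

* P. Deligne, *Théorie de Hodge II*, Publ. Math. IHÉS 40 (1971), 1.1.6–1.1.12, 4.1.1.
* C. Voisin, *Hodge Theory and Complex Algebraic Geometry I* (2002), Thm. 6.19, §7.1; *II* (2003),
  §3.1.1.
* S. Kleiman, *Algebraic cycles and the Weil conjectures* (1968), §1.2 (A).
-/

noncomputable section

open CategoryTheory AlgebraicGeometry

-- `Summit.HodgeConjecture.HodgeConjecture.Theorems` is the mandated namespace (single-problem summit:
-- Problem = Summit), which `linter.dupNamespace` flags on every declaration; the lakefile turns the
-- linter off tree-wide (weak option), restated here so stand-alone elaboration is warning-free too.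
set_option linter.dupNamespace false

namespace Summit.HodgeConjecture.HodgeConjecture.Theorems

open Literature.AlgebraicGeometry.Motives

/-- **`ClassicalGeometricVHS` unfolded to its two constructions.** Since Deligne's
tensor-filtration facts hold (`Motives.hodgeTensorFacts_holds`) and fibres of geometric VHS data
are automatically finite dimensional (`GeometricVHSData.finite_fiber`), the support item is
equivalent to: there is a classical Betti–Hodge datum `B` such that every smooth projective
`ℚ̄`-family over a smooth irreducible base carries, in every degree, a geometric VHS datum for `B`.
[cite: DeligneHodgeII1971, 1.1.12 and 4.1.1] -/
theorem classicalGeometricVHS_iff :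
    Theses.PeriodDeficiency.ClassicalGeometricVHS ↔
      ∃ B : BettiHodgeData ℂ, B.IsClassical ∧
        ∀ (σ : AlgebraicClosure ℚ →+* ℂ) ⦃𝒳₀ S₀ : SchemeOver (AlgebraicClosure ℚ)⦄ (f₀ : 𝒳₀ ⟶ S₀)
          (n i : ℕ), IsSmoothProjectiveFamily ((baseChangeHom σ).map f₀) n →
          IrreducibleSpace S₀.left → AlgebraicGeometry.Smooth S₀.hom →
          Nonempty (GeometricVHSData B ((baseChangeHom σ).map f₀) n i) := by
  constructor
  · rintro ⟨B, hB, -, hD⟩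
    refine ⟨B, hB, fun σ 𝒳₀ S₀ f₀ n i hf hirr hsm => ?_⟩
    obtain ⟨D, -⟩ := hD σ f₀ n i hf hirr hsm
    exact ⟨D⟩
  · rintro ⟨B, hB, hD⟩
    refine ⟨B, hB, hodgeTensorFacts_holds, fun σ 𝒳₀ S₀ f₀ n i hf hirr hsm => ?_⟩
    obtain ⟨D⟩ := hD σ f₀ n i hf hirr hsm
    exact ⟨D, D.finite_fiber⟩

/-- **Lower bound: the item implies model-independence of Hodge types.** `ClassicalGeometricVHS`
posits a Betti–Hodge datum pinned (`IsClassical`, clauses (i)/(i')) through every Hodge model, hence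
implies the named fact `HodgeTheory.hodgePQ_independent_of_hodgeModel`
(`Motives.BettiHodgeData.IsClassical.hodgePQ_independent`: the comparison
`ℂ ⊗_ℚ Hᵏ(X) → Hᵏ(X(ℂ); ℂ)` is onto, so two models cut out the same classes). That fact is open in
the tree; the item is at least as hard. [cite: VoisinHodgeI2002, §6.1.3 Prop. 6.11 and §7.1.1] -/
theorem hodgePQ_independent_of_classicalGeometricVHS
    (h : Theses.PeriodDeficiency.ClassicalGeometricVHS) :
    Literature.AlgebraicGeometry.HodgeTheory.hodgePQ_independent_of_hodgeModel := by
  obtain ⟨B, hB, -, -⟩ := h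
  exact hB.hodgePQ_independent

end Summit.HodgeConjecture.HodgeConjecture.Theorems

end
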